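import Literature.MathematicalPhysics.QuantumFieldTheory.Balaban1983to89.B11Eq30V0pTwoBackgrounds
import Literature.MathematicalPhysics.QuantumFieldTheory.Balaban1983to89.B11Eq63V0GroupCurrent

/-!
# `Balaban1983to89.B11Eq98V0CurrentBackgroundModulus` — T. Bałaban, *The variational problem and background fields in renormalization group method for lattice gauge theories*, Commun. Math. Phys. **102** (1985) 277–309 [Balaban1985Variational]: (63) p. 287, (90)/(92) pp. 291–292 and Prop. 4 (97)–(98) pp. 292–293, with [Balaban1985BackgroundPropagators] (3.1)–(3.5) pp. 390–391 — THE V₀-GROUP CURRENT AT TWO BACKGROUNDS: the one-bond functional of the whole `V₀(·, ∂q)` and the `|·|₍₋₃₎` modulus `‖curV0 ρ τ U₁ Y − curV0 ρ τ U₂ Y‖ ≤ K·R_V²·δ` on `‖Y‖ < R_V ≤ 1/16` — the displayed `δ_V` of `B11Eq98W80BackgroundModulus` / `B11Eq98W80ModulusLetterDefects` SUPPLIED at a fixed lattice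

statement-level skeleton of published theorems with citation tags; proofs where landed; nothing here is a claim about the Yang–Mills mass gap

PDF held: `paper:balaban1985-cmp102-variational-background` (journal page = PDF page + 276), pp. 287, 291–293, through the verbatim transcriptions of
`B11Eq90V0primeBond` ((90): `dV0primeBond`), `B11Eq92CommutatorFunctional` ((92): `dTerm39Bond`), `B11Eq90V0primeCurrent` / `B11Eq96CommutatorCurrent` /
`B11Eq63V0GroupCurrent` (the currents on the (115) carriers), `B11Eq98W80BackgroundModulus` (the `δ_V` display).

CITATION HEADER (lean-in-tree rule 2026-08-18).  WHAT IS REPRODUCED: nothing of print is asserted; print compares nothing between two backgrounds.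
Cell context (pub-balaban, NE9 chain, this lineage's W80 background-modulus line): `B11Eq98W80ModulusLetterDefects.exists_W80_background_modulus_of_letter_defects`
reduces the background modulus `δ_W` of the (L3) slot `W80` (displayed by `Support/NE9CurChartLipschitzAtFlat`) to the letter defects `δ_H, δ_C, δ_Δ` and ONE
remaining modulus, the V₀-group's: `(δ_V) ∀ Y, ‖Y‖ < R_V → ‖curV0 ρ τ U₁ Y − curV0 ρ τ U₂ (ιY)‖₍₋₃₎ ≤ δ_V`.  THIS FILE SUPPLIES (δ_V) with
`δ_V := K·R_V²·δ` for two backgrounds in the unit balls with `‖U₁(b) − U₂(b)‖ ≤ δ`, `K = 524288·e⁴(d − 1)Λ²L^{j_M}‖ρ‖‖τ‖` an explicit FIXED-LATTICE number.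

THE MECHANISM (print gives none between backgrounds; this file's).  `B11Eq63V0GroupCurrent.curV0 = curV0prime + curComm` is, bond by bond,
`Σ_{q∈st(b)} ρ((∂/∂A(b))V′₀(A, ∂q) + (∂/∂A(b))½ i tr((DA)(q)Σ[A′,A′]))` — by (39) the one-bond functional of the WHOLE `V₀(·, ∂q) = η⁻⁴ρ_q`, i.e.
`X ↦ (d/dt)V₀(A + tδ_bX, ∂q)|₀` ((63); `dV0Bond_apply`).  Its modulus between two backgrounds is a Cauchy estimate on the circle `|t| = s/(4‖X‖)` fed by
the VALUE modulus `B11Eq30V0pTwoBackgrounds.norm_V0p_sub_V0p_le` at size `2s` (§4); the `|·|₍₋₃₎` bound is then the bond-sum bookkeeping of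
`B11Eq90V0primeCurrent.norm_curV0prime_le` verbatim — weight `(Lʲ⁽ᵇ⁾η)³` against `#st(b) ≤ 2(d − 1)` functionals of size `O(ε₃²/w(q)²)`, the level
geometry `Lʲ⁽ᵇ⁾η ≤ Λw(q)`, and ONE new fixed-lattice letter, the top level `j(b) ≤ j_M` (§5).

WHAT IS PROVED (sorry-free; axioms `propext` / `Classical.choice` / `Quot.sound`; 0 def).
§4 ([5]'s abstract lattice) **`dV0Bond_apply`** ((39)/(63): `(dV0primeBond + dTerm39Bond)(X) = (d/dt)V₀(A + tδ_bX, ∂q)|_{t=0}`),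
   **`opNorm_dV0Bond_sub_le`** (`‖(dV0primeBond + dTerm39Bond)_U − (dV0primeBond + dTerm39Bond)_{U′}‖_{op} ≤ 24‖τ‖|η|⁻⁴·expTail 3 (16|η|s)/s·δ`
   for background-free size `≤ s` at `∂q`).
§5 (the (115) carriers) **`curV0_apply`** (the V₀-group current bondwise), **`opNorm_dV0Bond_sub_carrier_le`** (`≤ 262144·e⁴‖τ‖·ε₃²/(η·w(q)²)·δ` for
   `‖Y‖ < ε₃ ≤ 1/16`), **`norm_curV0_sub_curV0_le`** (`‖curV0 ρ τ U₁ Y − curV0 ρ τ U₂ Y‖₍₋₃₎ ≤ 524288·e⁴(d − 1)Λ²L^{j_M}‖ρ‖‖τ‖·ε₃²·δ`),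
   **`curV0_background_modulus`** (THE (δ_V) DISPLAY, one carrier: `∀ Y, ‖Y‖ < R_V → … ≤ K·R_V²·δ`, `0 < R_V ≤ 1/16`) and
   **`curV0_background_modulus_two_carriers`** (the (δ_V) binder of `exists_W80_background_modulus_of_letter_defects` VERBATIM, across the jet identity `ι`
   of two derivative letters `Dc₁, Dc₂` — `curV0` does not see the derivative letter, `B11Eq80CurrentTwoCarriers.curV0_jetId`),
   **`curV0_background_modulus_flat`** (the consumer's letters: `U` vs the flat background `1`, `‖U(b) − 1‖ ≤ ε`).

HONEST SCOPE — what is NOT claimed.  (i) CRUDE, FIXED-LATTICE CONSTANT: (38) is not used and the (39) commutator term is not summed by parts ((91)–(96)),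
so `K ∝ L^{j_M}` (the coarsest-to-finest scale ratio of the lattice at hand, `w(b)/η = L^{j(b)} ≤ L^{j_M}`) — a number at a fixed lattice, the generality of the consumer
`Support/NE9CurChartLipschitzAtFlat` (finite-lattice `K`), NOT print's lattice-uniform (90)/(96)/(98).  (ii) Hypotheses: bond variables of both backgrounds
in the unit balls of `𝔸`, `𝔸⁻¹`, `‖U₁(b) − U₂(b)‖ ≤ δ` (`0 ≤ δ`), continuous `ρ`, `τ`, `1 ≤ L`, the level-geometry letter `Λ` of `norm_curV0prime_le`
and the top level `j_M` (no unitarity, no trace property, no (38)).  (iii) READ AT `A` (the currents of `B11Eq63V0GroupCurrent`); the composition with the Sect. C map is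
`B11Eq98W80BackgroundModulus`'s.  (iv) DIVERGENCE D-pv27.4 inherited; nothing of (90), (96), (98), Prop. 4 or any summit statement asserted; NOT summit
progress (cell pub-balaban: NE9 NOT PRINTED / NOT PROVED; «NE9 ⇐ the named binders»; spine PROVED 0/9).  Unit `b2b-balaban-t4-ne9-formalise-leaf-05`
(NE9 crux-team leaf prover, gen 71).  Imports `B11Eq30V0pTwoBackgrounds` (this lineage), `B11Eq63V0GroupCurrent` ONLY; modifies nothing.
-/

noncomputable section

open NormedSpace Complex Metric Set Finset Filter Topology

namespace Literature.MathematicalPhysics.QuantumFieldTheory.Balaban1983to89.B11Eq98V0CurrentBackgroundModulus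

open Literature.MathematicalPhysics.QuantumFieldTheory.Balaban1983to89.Beta.TransportVertices
open Literature.MathematicalPhysics.QuantumFieldTheory.Balaban1983to89.B9Eq37Insertion
open Literature.MathematicalPhysics.QuantumFieldTheory.Balaban1983to89.B9Eq39Adjoint
open Literature.MathematicalPhysics.QuantumFieldTheory.Balaban1983to89.B11Eq26ActionExpansion
open Literature.MathematicalPhysics.QuantumFieldTheory.Balaban1983to89.B11Eq90V0Derivative
open Literature.MathematicalPhysics.QuantumFieldTheory.Balaban1983to89.B11Eq90StB
open Literature.MathematicalPhysics.QuantumFieldTheory.Balaban1983to89.B11Eq90V0primeBond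
open Literature.MathematicalPhysics.QuantumFieldTheory.Balaban1983to89.B11Eq92CommutatorFunctional
open Literature.MathematicalPhysics.QuantumFieldTheory.Balaban1983to89.B11Eq90V0primeCurrent
open Literature.MathematicalPhysics.QuantumFieldTheory.Balaban1983to89.B11Eq96CommutatorCurrent
open Literature.MathematicalPhysics.QuantumFieldTheory.Balaban1983to89.B11Eq63V0GroupCurrent
open Literature.MathematicalPhysics.QuantumFieldTheory.Balaban1983to89.B11Eq30V0pTwoBackgrounds
open B9SectCLatticeCarrier (Bond) open B4Sect5Torus (TSite)
open B11Eq115Space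
open B11Eq111FrakG (jetLinearEquiv)

variable {𝔸 : Type*} [NormedRing 𝔸] [NormedAlgebra ℂ 𝔸] [CompleteSpace 𝔸]

/-! ## §4 The one-bond functional of the whole `V₀(·, ∂q)` at two backgrounds -/

section Bond

variable {S : Type*} [Fintype S] [DecidableEq S] {ι : Type*} [Fintype ι] [LinearOrder ι]
variable (T : ι → Equiv.Perm S) {U U' : ι → S → 𝔸ˣ} {δ : ℝ}

/-- **(39) WITH (63): THE TWO GROUPS' ONE-BOND FUNCTIONALS SUM TO THE ONE-BOND FUNCTIONAL OF THE WHOLE `V₀(·, ∂q)`** —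
`((∂/∂A(b))V′₀)(A, ∂q)·X + ((∂/∂A(b)) ½ i tr((DA)(q)Σ[A′,A′]))·X = (d/dt)V₀(A + tδ_bX, ∂q)|_{t=0}` (`V₀ = V′₀ + ½ i tr(…)`, (39)).
[cite: Balaban1985Variational, (39) p.284, (63) p.287, (90) p.291, (92) p.292] -/
theorem dV0Bond_apply (U : ι → S → 𝔸ˣ) (η : ℝ) (τ : 𝔸 →L[ℂ] ℂ) (A : ι → S → 𝔸) (q : S × ι × ι) (μ₀ : ι) (x₀ : S) (X : 𝔸) :
    (dV0primeBond T U η τ A q μ₀ x₀ + dTerm39Bond T U η τ A q μ₀ x₀) X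
      = deriv (fun t : ℂ => V0p T U η (τ : 𝔸 →ₗ[ℂ] ℂ) (A + t • bondDelta μ₀ x₀ X) q.2.1 q.2.2 q.1) 0 := by
  have h1 : Differentiable ℂ (fun t : ℂ => V0primeP T U η (τ : 𝔸 →ₗ[ℂ] ℂ) (A + t • bondDelta μ₀ x₀ X) q.2.1 q.2.2 q.1) :=
    ((contDiff_V0primeP T U (n := 1) η τ q.2.1 q.2.2 q.1).differentiable (by norm_num)).comp (by fun_prop)
  have h2 : Differentiable ℂ (fun t : ℂ => term39 T U η (τ : 𝔸 →ₗ[ℂ] ℂ) (A + t • bondDelta μ₀ x₀ X) q.2.1 q.2.2 q.1) :=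
    ((contDiff_term39 T U (n := 1) η τ q.2.1 q.2.2 q.1).differentiable (by norm_num)).comp (by fun_prop)
  rw [show (dV0primeBond T U η τ A q μ₀ x₀ + dTerm39Bond T U η τ A q μ₀ x₀) X
      = dV0primeBond T U η τ A q μ₀ x₀ X + dTerm39Bond T U η τ A q μ₀ x₀ X from rfl,
    dV0primeBond_apply, dTerm39Bond_apply, ← deriv_add (h1 0) (h2 0)]
  congr 1
  funext t
  simp only [Pi.add_apply, V0primeP, sub_add_cancel]

omit [NormedAlgebra ℂ 𝔸] [CompleteSpace 𝔸] [Fintype S] [Fintype ι] in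
/-- The entries of the one-bond variation `δ_bX` have norm `≤ ‖X‖`. [cite: Balaban1985Variational, (90) p.291] -/
private theorem norm_bondDelta_le (μ₀ : ι) (x₀ : S) (X : 𝔸) (κ : ι) (y : S) : ‖bondDelta (S := S) μ₀ x₀ X κ y‖ ≤ ‖X‖ := by
  unfold bondDelta; split_ifs <;> simp

omit [CompleteSpace 𝔸] [Fintype S] [Fintype ι] in
/-- Along the complex line `A + tδ_bX` the background-free size at `∂q` grows at most by `4‖t‖‖X‖`. [cite: Balaban1985Variational, (63) p.287, (90) p.291] -/
private theorem freeSize_line_le (A : ι → S → 𝔸) (q : S × ι × ι) (μ₀ : ι) (x₀ : S) (X : 𝔸) (t : ℂ) :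
    ‖(A + t • bondDelta μ₀ x₀ X) q.2.1 (T q.2.2 q.1)‖ + ‖(A + t • bondDelta μ₀ x₀ X) q.2.2 q.1‖
        + ‖(A + t • bondDelta μ₀ x₀ X) q.2.1 q.1‖ + ‖(A + t • bondDelta μ₀ x₀ X) q.2.2 (T q.2.1 q.1)‖
      ≤ (‖A q.2.1 (T q.2.2 q.1)‖ + ‖A q.2.2 q.1‖ + ‖A q.2.1 q.1‖ + ‖A q.2.2 (T q.2.1 q.1)‖) + 4 * ‖t‖ * ‖X‖ := by
  have h : ∀ (κ : ι) (y : S), ‖(A + t • bondDelta μ₀ x₀ X) κ y‖ ≤ ‖A κ y‖ + ‖t‖ * ‖X‖ := fun κ y => by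
    simp only [Pi.add_apply, Pi.smul_apply]
    refine (norm_add_le _ _).trans (add_le_add le_rfl ?_)
    rw [norm_smul]
    exact mul_le_mul_of_nonneg_left (norm_bondDelta_le μ₀ x₀ X κ y) (norm_nonneg _)
  have h1 := h q.2.1 (T q.2.2 q.1); have h2 := h q.2.2 q.1; have h3 := h q.2.1 q.1; have h4 := h q.2.2 (T q.2.1 q.1)
  linarith

/-- **THE ONE-BOND FUNCTIONAL OF `V₀(·, ∂q)` AT TWO BACKGROUNDS — THE OPERATOR-NORM MODULUS**: for bond variables of `U`, `U′` in the unit balls with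
`‖U_b − U′_b‖ ≤ δ` and a configuration of background-free size `≤ s` (`0 < s`) at `∂q`,
`‖(dV0primeBond + dTerm39Bond)_U − (dV0primeBond + dTerm39Bond)_{U′}‖_{op} ≤ 24‖τ‖|η|⁻⁴·expTail 3 (16|η|s)/s·δ` — Cauchy on the circle
`|t| = s/(4‖X‖)`, where the size is `≤ 2s` and `norm_V0p_sub_V0p_le` bounds the difference of the two entire line functions.
[cite: Balaban1985Variational, (63) p.287, (90) p.291, (92) p.292; Balaban1985BackgroundPropagators, (3.1)-(3.5) pp.390-391] -/
theorem opNorm_dV0Bond_sub_le (hUn : ∀ μ x, ‖(U μ x : 𝔸)‖ ≤ 1 ∧ ‖(((U μ x)⁻¹ : 𝔸ˣ) : 𝔸)‖ ≤ 1)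
    (hUn' : ∀ μ x, ‖(U' μ x : 𝔸)‖ ≤ 1 ∧ ‖(((U' μ x)⁻¹ : 𝔸ˣ) : 𝔸)‖ ≤ 1) (hUU' : ∀ μ x, ‖(U μ x : 𝔸) - (U' μ x : 𝔸)‖ ≤ δ)
    (η : ℝ) (τ : 𝔸 →L[ℂ] ℂ) (A : ι → S → 𝔸) (q : S × ι × ι) (μ₀ : ι) (x₀ : S) {s : ℝ} (hs0 : 0 < s)
    (hs : ‖A q.2.1 (T q.2.2 q.1)‖ + ‖A q.2.2 q.1‖ + ‖A q.2.1 q.1‖ + ‖A q.2.2 (T q.2.1 q.1)‖ ≤ s) :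
    ‖(dV0primeBond T U η τ A q μ₀ x₀ + dTerm39Bond T U η τ A q μ₀ x₀)
        - (dV0primeBond T U' η τ A q μ₀ x₀ + dTerm39Bond T U' η τ A q μ₀ x₀)‖
      ≤ 24 * ‖τ‖ * (|η|⁻¹) ^ 4 * expTail 3 (16 * |η| * s) / s * δ := by
  have hδ0 : 0 ≤ δ := (norm_nonneg _).trans (hUU' q.2.1 q.1)
  have hE0 : 0 ≤ expTail 3 (16 * |η| * s) := expTail_nonneg 3 (by positivity)
  refine ContinuousLinearMap.opNorm_le_bound _ (by positivity) fun X => ?_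
  by_cases hX : X = 0
  · subst hX; simp
  have hX0 : 0 < ‖X‖ := norm_pos_iff.2 hX
  have hl : Differentiable ℂ (fun t : ℂ => V0p T U η (τ : 𝔸 →ₗ[ℂ] ℂ) (A + t • bondDelta μ₀ x₀ X) q.2.1 q.2.2 q.1) :=
    differentiable_V0p_line T U η τ A _ q.2.1 q.2.2 q.1
  have hl' : Differentiable ℂ (fun t : ℂ => V0p T U' η (τ : 𝔸 →ₗ[ℂ] ℂ) (A + t • bondDelta μ₀ x₀ X) q.2.1 q.2.2 q.1) :=
    differentiable_V0p_line T U' η τ A _ q.2.1 q.2.2 q.1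
  rw [show ((dV0primeBond T U η τ A q μ₀ x₀ + dTerm39Bond T U η τ A q μ₀ x₀)
        - (dV0primeBond T U' η τ A q μ₀ x₀ + dTerm39Bond T U' η τ A q μ₀ x₀)) X
      = (dV0primeBond T U η τ A q μ₀ x₀ + dTerm39Bond T U η τ A q μ₀ x₀) X
        - (dV0primeBond T U' η τ A q μ₀ x₀ + dTerm39Bond T U' η τ A q μ₀ x₀) X from rfl,
    dV0Bond_apply, dV0Bond_apply, ← deriv_sub (hl 0) (hl' 0)]
  have hr : 0 < s / (4 * ‖X‖) := by positivity
  have hC := Complex.norm_deriv_le_of_forall_mem_sphere_norm_le (c := 0)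
    (C := 6 * ‖τ‖ * (|η|⁻¹) ^ 4 * expTail 3 (16 * |η| * s) * δ) hr (hl.sub hl').diffContOnCl fun t ht => by
      rw [mem_sphere_zero_iff_norm] at ht
      have hsz : ‖(A + t • bondDelta μ₀ x₀ X) q.2.1 (T q.2.2 q.1)‖ + ‖(A + t • bondDelta μ₀ x₀ X) q.2.2 q.1‖
          + ‖(A + t • bondDelta μ₀ x₀ X) q.2.1 q.1‖ + ‖(A + t • bondDelta μ₀ x₀ X) q.2.2 (T q.2.1 q.1)‖ ≤ 2 * s := by
        refine (freeSize_line_le T A q μ₀ x₀ X t).trans ?_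
        have e : 4 * ‖t‖ * ‖X‖ = s := by rw [ht]; field_simp
        linarith
      have h := norm_V0p_sub_V0p_le T hUn hUn' hUU' η τ (A + t • bondDelta μ₀ x₀ X) q.2.1 q.2.2 q.1 (by positivity) hsz
      have e : 8 * |η| * (2 * s) = 16 * |η| * s := by ring
      rwa [e] at h
  refine hC.trans (le_of_eq ?_)
  field_simp
  ring

end Bond

/-! ## §5 The V₀-group current at two backgrounds on the (115) carriers: the `δ_V` display -/

section Carrier

variable {d : ℕ} {Pd : Fin d → ℕ} {L η : ℝ} [Fact (0 < L)] [Fact (0 < η)] {lev₀ : Bond d Pd → ℕ}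
  {κ' : Type*} [Fintype κ'] {lev₁ : κ' → ℕ} {Dc : (Bond d Pd → 𝔸) →ₗ[ℂ] (κ' → 𝔸)}

omit [CompleteSpace 𝔸] [Fact (0 < L)] [Fact (0 < η)] [Fintype κ'] in
/-- **THE V₀-GROUP CURRENT BONDWISE**: `curV0(Y)(b) = Σ_{q∈st(b)} ρ((∂/∂A(b))V′₀(A, ∂q) + (∂/∂A(b))½ i tr((DA)(q)Σ[A′,A′]))` at `A = curL Y` — the sum of the
one-bond functionals (90) and (92), i.e. of the whole `V₀(·, ∂q)` (`dV0Bond_apply`). [cite: Balaban1985Variational, (90) p.291, (92) p.292, (63) p.287] -/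
theorem curV0_apply (ρ : (𝔸 →L[ℂ] ℂ) →L[ℂ] 𝔸) (τ : 𝔸 →L[ℂ] ℂ) (U₀ : Bond d Pd → 𝔸ˣ) (Y : Space115 L η lev₀ lev₁ Dc) (b : Bond d Pd) :
    NegSup.equiv (levWeight L η lev₀ 3) 𝔸 (curV0 (lev₁ := lev₁) (Dc := Dc) ρ τ U₀ Y) b
      = ∑ q ∈ st Tsh b.2 b.1, ρ (dV0primeBond Tsh (Ucur U₀) η τ (curL (JetSup.equiv (levWeight L η lev₀ 1) (levWeight L η lev₁ 2) Dc Y)) q b.2 b.1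
          + dTerm39Bond Tsh (Ucur U₀) η τ (curL (JetSup.equiv (levWeight L η lev₀ 1) (levWeight L η lev₁ 2) Dc Y)) q b.2 b.1) := by
  simp only [curV0, NegSup.equiv_add, Pi.add_apply, curV0prime_apply, curComm_apply, map_add, Finset.sum_add_distrib]

/-- **THE ONE-BOND FUNCTIONAL OF `V₀(·, ∂q)` AT A (115) CONFIGURATION, TWO BACKGROUNDS**: for `‖Y‖ < ε₃ ≤ 1/16` (so the background-free size at `∂q` is
`≤ 4ε₃/w(q)`) and bond variables in the unit balls with `‖U₁(b) − U₂(b)‖ ≤ δ`,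
`‖(…)_{U₁} − (…)_{U₂}‖_{op} ≤ 262144·e⁴‖τ‖·ε₃²/(η·w(q)²)·δ` (`opNorm_dV0Bond_sub_le` at `s = 4ε₃/w(q)` with `expTail 3 x ≤ x³eˣ/6`, `x = 64ε₃η/w(q) ≤ 4` by
`η ≤ w(q)`). [cite: Balaban1985Variational, (90) p.291, (92) p.292, (97) p.293] -/
theorem opNorm_dV0Bond_sub_carrier_le (τ : 𝔸 →L[ℂ] ℂ) (U₁ U₂ : Bond d Pd → 𝔸ˣ)
    (hUn₁ : ∀ b, ‖(U₁ b : 𝔸)‖ ≤ 1 ∧ ‖(((U₁ b)⁻¹ : 𝔸ˣ) : 𝔸)‖ ≤ 1)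
    (hUn₂ : ∀ b, ‖(U₂ b : 𝔸)‖ ≤ 1 ∧ ‖(((U₂ b)⁻¹ : 𝔸ˣ) : 𝔸)‖ ≤ 1) {δ : ℝ} (hδ : ∀ b, ‖(U₁ b : 𝔸) - (U₂ b : 𝔸)‖ ≤ δ)
    (hL : 1 ≤ L) {ε₃ : ℝ} (hε₃ : 0 < ε₃) (ha : ε₃ ≤ 1 / 16) (q : TSite d Pd × Fin d × Fin d)
    (Y : Space115 L η lev₀ lev₁ Dc) (hY : ‖Y‖ < ε₃) (μ₀ : Fin d) (x₀ : TSite d Pd) :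
    ‖(dV0primeBond Tsh (Ucur U₁) η τ (curL (JetSup.equiv (levWeight L η lev₀ 1) (levWeight L η lev₁ 2) Dc Y)) q μ₀ x₀
          + dTerm39Bond Tsh (Ucur U₁) η τ (curL (JetSup.equiv (levWeight L η lev₀ 1) (levWeight L η lev₁ 2) Dc Y)) q μ₀ x₀)
        - (dV0primeBond Tsh (Ucur U₂) η τ (curL (JetSup.equiv (levWeight L η lev₀ 1) (levWeight L η lev₁ 2) Dc Y)) q μ₀ x₀
          + dTerm39Bond Tsh (Ucur U₂) η τ (curL (JetSup.equiv (levWeight L η lev₀ 1) (levWeight L η lev₁ 2) Dc Y)) q μ₀ x₀)‖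
      ≤ 262144 * Real.exp 4 * ‖τ‖ * ε₃ ^ 2 / (η * plaqWeight Tsh (levWeight L η lev₀ 1) q ^ 2) * δ := by
  have hη : 0 < η := Fact.out
  have hδ0 : 0 ≤ δ := (norm_nonneg _).trans (hδ (q.1, q.2.1))
  set w : Bond d Pd → ℝ := levWeight L η lev₀ 1 with hw
  have hw0 : ∀ b, 0 < w b := levWeight_pos (Fact.out) hη lev₀ 1
  set pw := plaqWeight Tsh w q with hpw
  have hpw0 : 0 < pw := plaqWeight_pos Tsh hw0 q
  have hηpw : η ≤ pw := le_plaqWeight Tsh (eta_le_levWeight_one (lev₀ := lev₀) hL) q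
  set A := curL (JetSup.equiv (levWeight L η lev₀ 1) (levWeight L η lev₁ 2) Dc Y) with hA
  -- the bond function around `∂q` is `≤ ε₃ / w(q)`
  have hAb : ∀ (κ : Fin d) (y : TSite d Pd), pw ≤ w (y, κ) → ‖A κ y‖ ≤ pw⁻¹ * ε₃ := by
    intro κ y hle
    have h1 : ‖A κ y‖ ≤ (w (y, κ))⁻¹ * ‖Y‖ := by
      have := NegSup.norm_apply_le (JetSup.fst Y) (y, κ)
      exact this.trans (mul_le_mul_of_nonneg_left (JetSup.norm_fst_le Y) (inv_nonneg.2 (hw0 _).le))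
    exact h1.trans (mul_le_mul (inv_anti₀ hpw0 hle) hY.le (norm_nonneg _) (inv_nonneg.2 hpw0.le))
  set s : ℝ := 4 * (pw⁻¹ * ε₃) with hs_def
  have hs0 : 0 < s := by positivity
  have hs : ‖A q.2.1 (Tsh q.2.2 q.1)‖ + ‖A q.2.2 q.1‖ + ‖A q.2.1 q.1‖ + ‖A q.2.2 (Tsh q.2.1 q.1)‖ ≤ s := by
    have h1 := hAb q.2.1 (Tsh q.2.2 q.1) (plaqWeight_le₃ Tsh w q)
    have h2 := hAb q.2.2 q.1 (plaqWeight_le₄ Tsh w q)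
    have h3 := hAb q.2.1 q.1 (plaqWeight_le₁ Tsh w q)
    have h4 := hAb q.2.2 (Tsh q.2.1 q.1) (plaqWeight_le₂ Tsh w q)
    linarith
  have h := opNorm_dV0Bond_sub_le Tsh (U := Ucur U₁) (U' := Ucur U₂) (fun μ x => hUn₁ (x, μ)) (fun μ x => hUn₂ (x, μ))
    (fun μ x => hδ (x, μ)) η τ A q μ₀ x₀ hs0 hs
  refine h.trans ?_
  -- `expTail 3 (16ηs) ≤ (16ηs)³ e⁴ / 6` since `16ηs = 64ε₃η/w(q) ≤ 64ε₃ ≤ 4`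
  rw [abs_of_pos hη]
  have hx0 : 0 ≤ 16 * η * s := by positivity
  have hηpw' : η * pw⁻¹ ≤ 1 := by rw [mul_inv_le_iff₀ hpw0, one_mul]; exact hηpw
  have hx4 : 16 * η * s ≤ 4 := by
    have e : 16 * η * s = 64 * ε₃ * (η * pw⁻¹) := by simp only [hs_def]; ring
    rw [e]; nlinarith
  have hexp : expTail 3 (16 * η * s) ≤ (16 * η * s) ^ 3 / 6 * Real.exp 4 :=
    (expTail_three_le hx0).trans (by gcongr)
  have hτ0 : 0 ≤ ‖τ‖ := norm_nonneg _
  calc 24 * ‖τ‖ * (η⁻¹) ^ 4 * expTail 3 (16 * η * s) / s * δ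
      ≤ 24 * ‖τ‖ * (η⁻¹) ^ 4 * ((16 * η * s) ^ 3 / 6 * Real.exp 4) / s * δ := by gcongr
    _ = 262144 * Real.exp 4 * ‖τ‖ * ε₃ ^ 2 / (η * pw ^ 2) * δ := by
        simp only [hs_def]
        field_simp
        ring

/-- **THE `|·|₍₋₃₎` MODULUS OF THE V₀-GROUP CURRENT BETWEEN TWO BACKGROUNDS**: for `‖Y‖ < ε₃ ≤ 1/16`, unit-ball backgrounds with `‖U₁(b) − U₂(b)‖ ≤ δ`
(`0 ≤ δ`), the level-geometry letter `Λ` of `norm_curV0prime_le` and levels `j(b) ≤ j_M`,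
`‖curV0 ρ τ U₁ Y − curV0 ρ τ U₂ Y‖₍₋₃₎ ≤ 524288·e⁴·(d − 1)·Λ²·L^{j_M}·‖ρ‖‖τ‖·ε₃²·δ` — the weight `w(b)³ = (L^{j(b)}η)³` against `#st(b) ≤ 2(d − 1)` functionals
(`opNorm_dV0Bond_sub_carrier_le`) and `w(b)³/(η·w(q)²) ≤ Λ²·L^{j_M}`.  CRUDE fixed-lattice constant (`L^{j_M}`). [cite: Balaban1985Variational, (97)-(98) p.293, (90) p.291] -/
theorem norm_curV0_sub_curV0_le (ρ : (𝔸 →L[ℂ] ℂ) →L[ℂ] 𝔸) (τ : 𝔸 →L[ℂ] ℂ) (U₁ U₂ : Bond d Pd → 𝔸ˣ)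
    (hUn₁ : ∀ b, ‖(U₁ b : 𝔸)‖ ≤ 1 ∧ ‖(((U₁ b)⁻¹ : 𝔸ˣ) : 𝔸)‖ ≤ 1)
    (hUn₂ : ∀ b, ‖(U₂ b : 𝔸)‖ ≤ 1 ∧ ‖(((U₂ b)⁻¹ : 𝔸ˣ) : 𝔸)‖ ≤ 1) {δ : ℝ} (hδ0 : 0 ≤ δ)
    (hδ : ∀ b, ‖(U₁ b : 𝔸) - (U₂ b : 𝔸)‖ ≤ δ)
    (hL : 1 ≤ L) {Λ ε₃ : ℝ} {jM : ℕ}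
    (hΛ : ∀ q ∈ posPlaq (TSite d Pd) (Fin d), ∀ (μ₀ : Fin d) (x₀ : TSite d Pd), q ∈ st Tsh μ₀ x₀ →
      levWeight L η lev₀ 1 (x₀, μ₀) ≤ Λ * plaqWeight Tsh (levWeight L η lev₀ 1) q)
    (hlev : ∀ b, lev₀ b ≤ jM) (hε₃ : 0 < ε₃) (ha : ε₃ ≤ 1 / 16)
    (Y : Space115 L η lev₀ lev₁ Dc) (hY : ‖Y‖ < ε₃) :
    ‖curV0 (lev₁ := lev₁) (Dc := Dc) ρ τ U₁ Y - curV0 (lev₁ := lev₁) (Dc := Dc) ρ τ U₂ Y‖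
      ≤ 524288 * Real.exp 4 * ((d - 1 : ℕ) : ℝ) * Λ ^ 2 * L ^ jM * ‖ρ‖ * ‖τ‖ * ε₃ ^ 2 * δ := by
  have hη : 0 < η := Fact.out
  have hL0 : 0 < L := Fact.out
  set w : Bond d Pd → ℝ := levWeight L η lev₀ 1 with hw
  have hw0 : ∀ b, 0 < w b := levWeight_pos (Fact.out) hη lev₀ 1
  set A := curL (JetSup.equiv (levWeight L η lev₀ 1) (levWeight L η lev₁ 2) Dc Y) with hA
  set C₀ : ℝ := 262144 * Real.exp 4 * ‖τ‖ * ε₃ ^ 2 with hC₀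
  have hC₀0 : 0 ≤ C₀ := by positivity
  have hLj : 0 < L ^ jM := by positivity
  refine (NegSup.norm_le_iff (by positivity)).2 fun b => ?_
  have hwb : 0 < w b := hw0 b
  have hwbM : w b ≤ L ^ jM * η := by
    have e : w b = L ^ lev₀ b * η := by simp [hw, levWeight_apply]
    rw [e]
    exact mul_le_mul_of_nonneg_right (pow_le_pow_right₀ hL (hlev b)) hη.le
  rw [NegSup.equiv_sub, Pi.sub_apply, curV0_apply, curV0_apply, ← Finset.sum_sub_distrib]
  have hw3 : levWeight L η lev₀ 3 b = w b ^ 3 := by simp [hw, levWeight_apply]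
  rw [hw3]
  have hterm : ∀ q ∈ st Tsh b.2 b.1,
      w b ^ 3 * ‖ρ (dV0primeBond Tsh (Ucur U₁) η τ A q b.2 b.1 + dTerm39Bond Tsh (Ucur U₁) η τ A q b.2 b.1)
          - ρ (dV0primeBond Tsh (Ucur U₂) η τ A q b.2 b.1 + dTerm39Bond Tsh (Ucur U₂) η τ A q b.2 b.1)‖
        ≤ Λ ^ 2 * L ^ jM * ‖ρ‖ * C₀ * δ := by
    intro q hq
    have hpw0 : 0 < plaqWeight Tsh w q := plaqWeight_pos Tsh hw0 q
    have hℓ := opNorm_dV0Bond_sub_carrier_le (lev₁ := lev₁) (Dc := Dc) τ U₁ U₂ hUn₁ hUn₂ hδ hL hε₃ ha q Y hY b.2 b.1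
    rw [← map_sub]
    have hρℓ := (ρ.le_opNorm _).trans (mul_le_mul_of_nonneg_left hℓ (norm_nonneg ρ))
    have hrat : w b ^ 3 / (η * plaqWeight Tsh w q ^ 2) ≤ Λ ^ 2 * L ^ jM := by
      have h1 : w b ≤ Λ * plaqWeight Tsh w q := hΛ q (st_subset_posPlaq Tsh b.2 b.1 hq) b.2 b.1 hq
      have h2 : w b ^ 2 ≤ Λ ^ 2 * plaqWeight Tsh w q ^ 2 := by
        rw [← mul_pow]; exact pow_le_pow_left₀ hwb.le h1 2
      rw [div_le_iff₀ (by positivity)]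
      calc w b ^ 3 = w b * w b ^ 2 := by ring
        _ ≤ (L ^ jM * η) * (Λ ^ 2 * plaqWeight Tsh w q ^ 2) := mul_le_mul hwbM h2 (by positivity) (by positivity)
        _ = Λ ^ 2 * L ^ jM * (η * plaqWeight Tsh w q ^ 2) := by ring
    calc w b ^ 3 * ‖ρ ((dV0primeBond Tsh (Ucur U₁) η τ A q b.2 b.1 + dTerm39Bond Tsh (Ucur U₁) η τ A q b.2 b.1)
            - (dV0primeBond Tsh (Ucur U₂) η τ A q b.2 b.1 + dTerm39Bond Tsh (Ucur U₂) η τ A q b.2 b.1))‖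
        ≤ w b ^ 3 * (‖ρ‖ * (C₀ / (η * plaqWeight Tsh w q ^ 2) * δ)) := mul_le_mul_of_nonneg_left hρℓ (by positivity)
      _ = (w b ^ 3 / (η * plaqWeight Tsh w q ^ 2)) * (‖ρ‖ * C₀ * δ) := by
          field_simp
      _ ≤ (Λ ^ 2 * L ^ jM) * (‖ρ‖ * C₀ * δ) := mul_le_mul_of_nonneg_right hrat (by positivity)
      _ = Λ ^ 2 * L ^ jM * ‖ρ‖ * C₀ * δ := by ring
  have hcard := card_st_le Tsh b.2 b.1
  rw [Fintype.card_fin] at hcard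
  have hK0 : 0 ≤ Λ ^ 2 * L ^ jM * ‖ρ‖ * C₀ * δ := by positivity
  calc w b ^ 3 * ‖∑ q ∈ st Tsh b.2 b.1, (ρ (dV0primeBond Tsh (Ucur U₁) η τ A q b.2 b.1 + dTerm39Bond Tsh (Ucur U₁) η τ A q b.2 b.1)
          - ρ (dV0primeBond Tsh (Ucur U₂) η τ A q b.2 b.1 + dTerm39Bond Tsh (Ucur U₂) η τ A q b.2 b.1))‖
      ≤ w b ^ 3 * ∑ q ∈ st Tsh b.2 b.1, ‖ρ (dV0primeBond Tsh (Ucur U₁) η τ A q b.2 b.1 + dTerm39Bond Tsh (Ucur U₁) η τ A q b.2 b.1)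
          - ρ (dV0primeBond Tsh (Ucur U₂) η τ A q b.2 b.1 + dTerm39Bond Tsh (Ucur U₂) η τ A q b.2 b.1)‖ :=
        mul_le_mul_of_nonneg_left (norm_sum_le _ _) (by positivity)
    _ = ∑ q ∈ st Tsh b.2 b.1, w b ^ 3 * ‖ρ (dV0primeBond Tsh (Ucur U₁) η τ A q b.2 b.1 + dTerm39Bond Tsh (Ucur U₁) η τ A q b.2 b.1)
          - ρ (dV0primeBond Tsh (Ucur U₂) η τ A q b.2 b.1 + dTerm39Bond Tsh (Ucur U₂) η τ A q b.2 b.1)‖ := Finset.mul_sum _ _ _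
    _ ≤ ∑ q ∈ st Tsh b.2 b.1, Λ ^ 2 * L ^ jM * ‖ρ‖ * C₀ * δ := Finset.sum_le_sum hterm
    _ = (st Tsh b.2 b.1).card * (Λ ^ 2 * L ^ jM * ‖ρ‖ * C₀ * δ) := by rw [Finset.sum_const, nsmul_eq_mul]
    _ ≤ (2 * (d - 1) : ℕ) * (Λ ^ 2 * L ^ jM * ‖ρ‖ * C₀ * δ) := by gcongr
    _ = 524288 * Real.exp 4 * ((d - 1 : ℕ) : ℝ) * Λ ^ 2 * L ^ jM * ‖ρ‖ * ‖τ‖ * ε₃ ^ 2 * δ := by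
        simp only [hC₀]; push_cast; ring

/-- **THE (δ_V) DISPLAY OF `B11Eq98W80BackgroundModulus` SUPPLIED (ONE CARRIER)**: on the ball `‖Y‖ < R_V` (`0 < R_V ≤ 1/16`) of the space (115),
`‖curV0 ρ τ U₁ Y − curV0 ρ τ U₂ Y‖₍₋₃₎ ≤ δ_V` with `δ_V := 524288·e⁴(d − 1)Λ²L^{j_M}‖ρ‖‖τ‖·R_V²·δ` (fixed lattice; unit-ball backgrounds with
`‖U₁(b) − U₂(b)‖ ≤ δ`, `0 ≤ δ`). [cite: Balaban1985Variational, (98) p.293, (90) p.291] -/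
theorem curV0_background_modulus (ρ : (𝔸 →L[ℂ] ℂ) →L[ℂ] 𝔸) (τ : 𝔸 →L[ℂ] ℂ) (U₁ U₂ : Bond d Pd → 𝔸ˣ)
    (hUn₁ : ∀ b, ‖(U₁ b : 𝔸)‖ ≤ 1 ∧ ‖(((U₁ b)⁻¹ : 𝔸ˣ) : 𝔸)‖ ≤ 1)
    (hUn₂ : ∀ b, ‖(U₂ b : 𝔸)‖ ≤ 1 ∧ ‖(((U₂ b)⁻¹ : 𝔸ˣ) : 𝔸)‖ ≤ 1) {δ : ℝ} (hδ0 : 0 ≤ δ)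
    (hδ : ∀ b, ‖(U₁ b : 𝔸) - (U₂ b : 𝔸)‖ ≤ δ)
    (hL : 1 ≤ L) {Λ RV : ℝ} {jM : ℕ}
    (hΛ : ∀ q ∈ posPlaq (TSite d Pd) (Fin d), ∀ (μ₀ : Fin d) (x₀ : TSite d Pd), q ∈ st Tsh μ₀ x₀ →
      levWeight L η lev₀ 1 (x₀, μ₀) ≤ Λ * plaqWeight Tsh (levWeight L η lev₀ 1) q)
    (hlev : ∀ b, lev₀ b ≤ jM) (hRV : 0 < RV) (hRV' : RV ≤ 1 / 16) :
    ∀ Y : Space115 L η lev₀ lev₁ Dc, ‖Y‖ < RV →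
      ‖curV0 (lev₁ := lev₁) (Dc := Dc) ρ τ U₁ Y - curV0 (lev₁ := lev₁) (Dc := Dc) ρ τ U₂ Y‖
        ≤ (524288 * Real.exp 4 * ((d - 1 : ℕ) : ℝ) * Λ ^ 2 * L ^ jM * ‖ρ‖ * ‖τ‖ * RV ^ 2) * δ := by
  intro Y hY
  calc _ ≤ _ := norm_curV0_sub_curV0_le (lev₁ := lev₁) (Dc := Dc) ρ τ U₁ U₂ hUn₁ hUn₂ hδ0 hδ hL hΛ hlev hRV hRV' Y hY
    _ = _ := by ring

/-- **THE (δ_V) BINDER OF `exists_W80_background_modulus_of_letter_defects`, VERBATIM, ACROSS TWO CARRIERS**: for two derivative letters `Dc₁, Dc₂` and the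
jet identity `ι : Space115(Dc₁) → Space115(Dc₂)`, `∀ Y, ‖Y‖ < R_V → ‖curV0 ρ τ U₁ Y − curV0 ρ τ U₂ (ιY)‖₍₋₃₎ ≤ δ_V` with the same `δ_V` — the V₀-group current
does not see the derivative letter (`B11Eq80CurrentTwoCarriers.curV0_jetId`, definitional). [cite: Balaban1985Variational, (98) p.293, (115) p.294] -/
theorem curV0_background_modulus_two_carriers [FiniteDimensional ℂ 𝔸] {Dc₁ Dc₂ : (Bond d Pd → 𝔸) →ₗ[ℂ] (κ' → 𝔸)}
    (ρ : (𝔸 →L[ℂ] ℂ) →L[ℂ] 𝔸) (τ : 𝔸 →L[ℂ] ℂ) (U₁ U₂ : Bond d Pd → 𝔸ˣ)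
    (hUn₁ : ∀ b, ‖(U₁ b : 𝔸)‖ ≤ 1 ∧ ‖(((U₁ b)⁻¹ : 𝔸ˣ) : 𝔸)‖ ≤ 1)
    (hUn₂ : ∀ b, ‖(U₂ b : 𝔸)‖ ≤ 1 ∧ ‖(((U₂ b)⁻¹ : 𝔸ˣ) : 𝔸)‖ ≤ 1) {δ : ℝ} (hδ0 : 0 ≤ δ)
    (hδ : ∀ b, ‖(U₁ b : 𝔸) - (U₂ b : 𝔸)‖ ≤ δ)
    (hL : 1 ≤ L) {Λ RV : ℝ} {jM : ℕ}
    (hΛ : ∀ q ∈ posPlaq (TSite d Pd) (Fin d), ∀ (μ₀ : Fin d) (x₀ : TSite d Pd), q ∈ st Tsh μ₀ x₀ →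
      levWeight L η lev₀ 1 (x₀, μ₀) ≤ Λ * plaqWeight Tsh (levWeight L η lev₀ 1) q)
    (hlev : ∀ b, lev₀ b ≤ jM) (hRV : 0 < RV) (hRV' : RV ≤ 1 / 16) :
    ∀ Y : Space115 L η lev₀ lev₁ Dc₁, ‖Y‖ < RV →
      ‖curV0 (lev₁ := lev₁) (Dc := Dc₁) ρ τ U₁ Y - curV0 (lev₁ := lev₁) (Dc := Dc₂) ρ τ U₂
          ((LinearMap.toContinuousLinearMap ((jetLinearEquiv L η lev₀ lev₁ Dc₂).symm.toLinearMap ∘ₗ (jetLinearEquiv L η lev₀ lev₁ Dc₁).toLinearMap)) Y)‖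
        ≤ (524288 * Real.exp 4 * ((d - 1 : ℕ) : ℝ) * Λ ^ 2 * L ^ jM * ‖ρ‖ * ‖τ‖ * RV ^ 2) * δ :=
  curV0_background_modulus (lev₁ := lev₁) (Dc := Dc₁) ρ τ U₁ U₂ hUn₁ hUn₂ hδ0 hδ hL hΛ hlev hRV hRV'

/-- **THE (δ_V) BINDER AT THE FLAT POINT** (the consumer `Support/NE9CurChartLipschitzAtFlat`'s letters): a unit-ball background `U` with `‖U(b) − 1‖ ≤ ε`
(`0 ≤ ε`) against the flat background `1`, across the jet identity of two derivative letters `Dc₁, Dc₂` (e.g. `∇_U`, `∇_1`):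
`∀ Y, ‖Y‖ < R_V → ‖curV0 ρ τ U Y − curV0 ρ τ 1 (ιY)‖₍₋₃₎ ≤ (524288·e⁴(d − 1)Λ²L^{j_M}‖ρ‖‖τ‖R_V²)·ε`. [cite: Balaban1985Variational, (98) p.293, (115) p.294] -/
theorem curV0_background_modulus_flat [NormOneClass 𝔸] [FiniteDimensional ℂ 𝔸] {Dc₁ Dc₂ : (Bond d Pd → 𝔸) →ₗ[ℂ] (κ' → 𝔸)}
    (ρ : (𝔸 →L[ℂ] ℂ) →L[ℂ] 𝔸) (τ : 𝔸 →L[ℂ] ℂ) (U : Bond d Pd → 𝔸ˣ)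
    (hUn : ∀ b, ‖(U b : 𝔸)‖ ≤ 1 ∧ ‖(((U b)⁻¹ : 𝔸ˣ) : 𝔸)‖ ≤ 1) {ε : ℝ} (hε : 0 ≤ ε) (hUε : ∀ b, ‖(U b : 𝔸) - 1‖ ≤ ε)
    (hL : 1 ≤ L) {Λ RV : ℝ} {jM : ℕ}
    (hΛ : ∀ q ∈ posPlaq (TSite d Pd) (Fin d), ∀ (μ₀ : Fin d) (x₀ : TSite d Pd), q ∈ st Tsh μ₀ x₀ →
      levWeight L η lev₀ 1 (x₀, μ₀) ≤ Λ * plaqWeight Tsh (levWeight L η lev₀ 1) q)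
    (hlev : ∀ b, lev₀ b ≤ jM) (hRV : 0 < RV) (hRV' : RV ≤ 1 / 16) :
    ∀ Y : Space115 L η lev₀ lev₁ Dc₁, ‖Y‖ < RV →
      ‖curV0 (lev₁ := lev₁) (Dc := Dc₁) ρ τ U Y - curV0 (lev₁ := lev₁) (Dc := Dc₂) ρ τ (fun _ : Bond d Pd => (1 : 𝔸ˣ))
          ((LinearMap.toContinuousLinearMap ((jetLinearEquiv L η lev₀ lev₁ Dc₂).symm.toLinearMap ∘ₗ (jetLinearEquiv L η lev₀ lev₁ Dc₁).toLinearMap)) Y)‖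
        ≤ (524288 * Real.exp 4 * ((d - 1 : ℕ) : ℝ) * Λ ^ 2 * L ^ jM * ‖ρ‖ * ‖τ‖ * RV ^ 2) * ε :=
  curV0_background_modulus_two_carriers (lev₁ := lev₁) (Dc₁ := Dc₁) (Dc₂ := Dc₂) ρ τ U (fun _ => 1) hUn
    (fun _ => ⟨by simp, by simp⟩) hε (fun b => by simpa using hUε b) hL hΛ hlev hRV hRV'

end Carrier

end Literature.MathematicalPhysics.QuantumFieldTheory.Balaban1983to89.B11Eq98V0CurrentBackgroundModulus

end
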